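/-
Copyright: the b2b-balaban cell (near-miss cell 7), T⁴-continuum fan-out, NE7b ROUND-2 swarm `t4-ne7b-formalise-*`
(seat leaf-01), row S6 «H2d zones» of lineage t4-ne7b-p1's claim table `LEAVES-NE7b.md` — TH re-target (R-OWNER-22-1).
Released under the licence of the surrounding project.
-/
import Summits.QuantumFields.BalabanUV.T4Continuum.Support.HistoryShapeZones
import Summits.QuantumFields.BalabanUV.T4Continuum.Support.HistoryZones

/-!
# History zones along a shape map, IIb: the zone map READ OFF THE TAGGED BIRTHS' REGIONS, and its reading

Summits-side support leaf of the T⁴-continuum cell (rung (B)+1 on a FINITE torus only; NOT infinite volume, NOT the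
mass gap, NOT the Clay statement; NOT a proof of the spine estimate NE7b).  NE7b ROUND-2 swarm, row S6 (H2d), TH
re-target.  The verbatim transport along a shape map `sh : ε → PEv` of `Support/HistoryZones` §2–§7 (`sh = id` recovers
it): every TAGGED birth carries its own region, so NOTHING asks the shapes to be distinct.  [folklore] bookkeeping over
the lineage's OWN carriers; nothing is quoted from print, nothing printed is asserted, no `[cite:]` tag, no `Prop` fact
minted (`BirthRegionsS` is a HYPOTHESIS SHAPE — the three laws the realisation layer must make true — never asserted).

WHAT.
* §2 **`regZoneS sh L reg t X`** — the union over the births `b` of `X` with `(sh b).step ≤ t` of the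
  `(t − (sh b).step)`-fold blocking of `reg b`; renewal adds nothing, merger = union, by construction;
  **`BirthRegionsS sh n L K Cb G reg`** (in range; diameter `≤ Cb·wtPEv (sh b)`; CONTACT at every merger node);
  **`zoneReading_of_birthRegionsS`** ⇒ `HistoryShapeZones.ZoneReadingS`.
* §3 (p1) `isScale_root_of_leafStepsS`, (p2) `root_block_mem_regZoneS` for any placement putting each birth `b` on a
  cell of scale `(sh b).step` whose block lies in `reg b` (`HistoryZones.birthCell` of an anchor does).
* §4 consumers, inputs plugged: **`admZ_of_birthRegionsS`**, **`card_admZSet_le_of_birthRegionsS`** = the socket's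
  `mult(G′) = Kz^{#merges}·∏ Q(wcntS sh G′,σ,·)^d·(L^d)^{partnerAges}`.
* §5 **`birthRegionsS_of_faceConnected`**: `inRange`∕`diam_le` DISCHARGED with `Cb = 4·2^d` for regions recorded as
  reduced cube families `redZone (n·L^{K−(sh b).step}) (Z b)`, `Z b ⊆ ℤ^d` non-empty FACE-CONNECTED,
  `treeLen (Z b) ≤ (sh b).fat` — one cell ≡ one `MR_j`-cube (R-OWNER-22-2 (U1)); contact stays the history's datum.
* §6 sanity, decided, on a tagged tree with a REPEATED birth shape (two class-`1` regions at one step, in contact).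

Part III (`HistoryZonesLive.lean`, = S1b merged per R-OWNER-22-3 (3)): the realisation predicate on row S3's
payload-carrying `Pedigree` (regions WITH contact layer, CONTACT ORDER along the chain, anchors) and the contact law
for `genT X` along `HistoryGen.genT_eq` by `HistoryZonesTagged.mergeNodes_chainMerge`.  Walls unchanged: (ID)
G-ne7bp1g9-1 (H3), (E2)∕(R1) G-ne7bp1-1.  NE7b discharge: no date.

HONEST DEPENDENCY (cell): continuum YM on T⁴ ⇐ BetaPertH ∧ nine spine estimates (0/9 proved); BetaPertH ⇐ (D1) ∧ (D4)
∧ CAP+tail; G-an2-4 gates asym, D1 and NE2/3/4.  This file changes none of it.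
-/

open Finset
open Literature.MathematicalPhysics.QuantumFieldTheory.Balaban1983to89
open Literature.MathematicalPhysics.QuantumFieldTheory.Balaban1983to89.B13ScaleTransfer
open Literature.MathematicalPhysics.QuantumFieldTheory.Balaban1983to89.TreeLength
open T4PersistenceDictionary T4PartnerMultiplicity
open Summit.QuantumFields.BalabanUV.T4Continuum.PlacementSkeleton
open Summit.QuantumFields.BalabanUV.T4Continuum.Crowding
open Summit.QuantumFields.BalabanUV.T4Continuum.ZoneSkeleton
open Summit.QuantumFields.BalabanUV.T4Continuum.ZoneCrowd
open Summit.QuantumFields.BalabanUV.T4Continuum.ZoneTorus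

namespace Summit.QuantumFields.BalabanUV.T4Continuum.HistoryZones

noncomputable section

variable {d : ℕ} {ε : Type*} [DecidableEq ε] (sh : ε → PEv)

/-! ## §2 The zone map read off the birth regions of the tagged births -/

/-- **THE ZONE OF A STRUCTURE AT STEP `t`, READ OFF ITS TAGGED BIRTH REGIONS**: the union over the births `b` of `X`
with `(sh b).step ≤ t` of the `(t − (sh b).step)`-fold blocking of `reg b`. [folklore] -/
def regZoneS (L : ℕ) (reg : ε → Finset (Fin d → ℕ)) (t : ℕ) (X : Gen ε) : Finset (Fin d → ℕ) :=
  (births X).biUnion fun b => if (sh b).step ≤ t then (blocks L)^[t - (sh b).step] (reg b) else ∅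

variable {sh}

/-- membership in the zone [folklore] -/
theorem mem_regZoneS {L : ℕ} {reg : ε → Finset (Fin d → ℕ)} {t : ℕ} {X : Gen ε} {u : Fin d → ℕ} :
    u ∈ regZoneS sh L reg t X ↔ ∃ b ∈ births X, (sh b).step ≤ t ∧ u ∈ (blocks L)^[t - (sh b).step] (reg b) := by
  rw [regZoneS, mem_biUnion]
  refine exists_congr fun b => and_congr_right fun _ => ?_
  split_ifs with h <;> simp [h]

/-- a blocked birth region of a birth already happened lies in the zone [folklore] -/
theorem iterate_blocks_subset_regZoneS {L : ℕ} {reg : ε → Finset (Fin d → ℕ)} {t : ℕ} {X : Gen ε} {b : ε}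
    (hb : b ∈ births X) (hbt : (sh b).step ≤ t) : (blocks L)^[t - (sh b).step] (reg b) ⊆ regZoneS sh L reg t X :=
  fun _ hu => mem_regZoneS.2 ⟨b, hb, hbt, hu⟩

/-- a renewal adds nothing [folklore] -/
@[simp] theorem regZoneS_renew (L : ℕ) (reg : ε → Finset (Fin d → ℕ)) (t : ℕ) (X : Gen ε) (e : ε) (h : ℕ) :
    regZoneS sh L reg t (Gen.renew X e h) = regZoneS sh L reg t X := rfl

/-- a merger's zone is the union of the partners' zones [folklore] -/
theorem regZoneS_merge (L : ℕ) (reg : ε → Finset (Fin d → ℕ)) (t : ℕ) (X Y : Gen ε) (e : ε) :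
    regZoneS sh L reg t (Gen.merge X Y e) = regZoneS sh L reg t X ∪ regZoneS sh L reg t Y := by
  simp only [regZoneS, births_merge, union_biUnion]

/-- the zone of a bare birth at its own shape-step is its birth region [folklore] -/
@[simp] theorem regZoneS_born_self (L : ℕ) (reg : ε → Finset (Fin d → ℕ)) (b : ε) (j : ℕ) :
    regZoneS sh L reg (sh b).step (Gen.born b j) = reg b := by
  simp [regZoneS]

omit [DecidableEq ε] in
/-- births of a sub-structure are births of the whole (any alphabet) [folklore] -/
theorem births_subset_of_subE [DecidableEq ε] : ∀ {X G : Gen ε}, Sub X G → births X ⊆ births G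
  | _, _, Sub.refl _ => subset_rfl
  | _, _, Sub.renew _ _ hs => (births_subset_of_subE hs).trans (by rw [births_renew])
  | _, _, Sub.left B _ hs => (births_subset_of_subE hs).trans (by rw [births_merge]; exact subset_union_left)
  | _, _, Sub.right A _ hs => (births_subset_of_subE hs).trans (by rw [births_merge]; exact subset_union_right)

omit [DecidableEq ε] in
/-- under chronology every birth of a structure is dated no later than its formation time (any dating) [folklore] -/
theorem st_le_ftime_of_chrono [DecidableEq ε] (st : ε → ℕ) :
    ∀ {G : Gen ε}, Chrono st G → ∀ b ∈ births G, st b ≤ ftime st G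
  | Gen.born b' j, _, b, hb => by
      simp only [births_born, mem_singleton] at hb
      exact hb ▸ le_rfl
  | Gen.renew G e h, hc, b, hb => st_le_ftime_of_chrono st (G := G) hc b hb
  | Gen.merge X Y e, hc, b, hb => by
      rw [births_merge] at hb
      rcases mem_union.1 hb with hb | hb
      · exact hc.2.2 b (mem_union_left _ (mem_union_left _ hb))
      · exact hc.2.2 b (mem_union_right _ (mem_union_left _ hb))

variable (sh)

/-- **THE BIRTH-REGION LAWS ALONG A SHAPE MAP** (hypothesis shape): every tagged birth's region is in range of its
shape-level; spans at most `Cb·wtPEv (sh b)`; and at every merger node the partners' zones share a block at the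
merger's shape-step (CONTACT). [folklore] -/
structure BirthRegionsS (n L K : ℕ) (Cb : ℝ) (G : Gen ε) (reg : ε → Finset (Fin d → ℕ)) : Prop where
  /-- birth regions are level-`(sh b).step` zones of the cutoff-`K` torus -/
  inRange : ∀ b ∈ births G, InRange (n * L ^ (K - (sh b).step)) (reg b)
  /-- a birth region spans at most `Cb·wtPEv (sh b)` cells -/
  diam_le : ∀ b ∈ births G, (diam (n * L ^ (K - (sh b).step)) (reg b) : ℝ) ≤ Cb * wtPEv (sh b)
  /-- merger contact: the partners' zones share a cell at the merger's shape-step -/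
  contact : ∀ (X Y : Gen ε) (e : ε), Sub (Gen.merge X Y e) G →
    ∃ z, z ∈ regZoneS sh L reg (sh e).step X ∧ z ∈ regZoneS sh L reg (sh e).step Y

variable {sh}

/-- the zone of a sub-structure is in range of its level [folklore] -/
theorem inRange_regZoneS {n L K : ℕ} (hL : 1 ≤ L) {Cb : ℝ} {G : Gen ε} {reg : ε → Finset (Fin d → ℕ)}
    (hB : BirthRegionsS sh n L K Cb G reg) {X : Gen ε} (hs : Sub X G) (t : ℕ) :
    InRange (n * L ^ (K - t)) (regZoneS sh L reg t X) := by
  intro u hu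
  obtain ⟨b, hb, hbt, hu⟩ := mem_regZoneS.1 hu
  have hr := hB.inRange b (births_subset_of_subE hs hb)
  have hle : n * L ^ (K - (sh b).step) ≤ n * L ^ (K - t) * L ^ (t - (sh b).step) := by
    rw [mul_assoc, ← pow_add]
    exact Nat.mul_le_mul_left _ (Nat.pow_le_pow_right hL (by omega))
  exact inRange_iterate_blocks hL (n * L ^ (K - t)) (t - (sh b).step) (inRange_mono hle hr) u hu

/-- **THE BIRTH REGIONS GIVE THE ZONE READING (along `sh`).**  `L ≥ 1`, `G` chronological for `step ∘ sh`, birth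
regions obeying the three laws ⇒ `ZoneReadingS sh n L K Cb G (regZoneS sh L reg)`. [folklore] -/
theorem zoneReading_of_birthRegionsS {n L K : ℕ} (hL : 1 ≤ L) {Cb : ℝ} {G : Gen ε}
    (hchr : Chrono (PEv.step ∘ sh) G) {reg : ε → Finset (Fin d → ℕ)} (hB : BirthRegionsS sh n L K Cb G reg) :
    ZoneReadingS sh n L K Cb G (regZoneS sh L reg) where
  inRange t X hs := inRange_regZoneS hL hB hs t
  birth b j hs := by
    rw [regZoneS_born_self]
    exact hB.diam_le b (births_subset_of_subE hs (by simp))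
  union X Y e hs := by rw [regZoneS_merge]
  overlap := hB.contact
  step X t hs hft hK := by
    intro u hu
    obtain ⟨b, hb, -, hu⟩ := mem_regZoneS.1 hu
    have hbt : (sh b).step ≤ t :=
      (st_le_ftime_of_chrono (PEv.step ∘ sh) (chrono_of_sub (PEv.step ∘ sh) hs hchr) b hb).trans hft
    have heq : t + 1 - (sh b).step = (t - (sh b).step) + 1 := by omega
    rw [heq, Function.iterate_succ_apply'] at hu
    exact image_subset_image (iterate_blocks_subset_regZoneS hb hbt) hu
  renew X e h t hs := by rw [regZoneS_renew]

/-! ## §3 The two positional facts along a shape map -/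

omit [DecidableEq ε] in
/-- with leaf steps (`(sh b).step = j` on every leaf `born b j`, e.g. from `T4TaggedShapeBanking.ConsistentT`), the
root step of every sub-structure is its root's shape-step [folklore] -/
theorem rootStep_eq_root_stepS {G : Gen ε} (hG : ∀ (b : ε) (j : ℕ), Sub (Gen.born b j) G → (sh b).step = j) :
    ∀ {X : Gen ε}, Sub X G → X.rootStep = (sh X.root).step
  | Gen.born b j, hs => (hG b j hs).symm
  | Gen.renew X e h, hs => by
      rw [Gen.rootStep_renew]
      exact rootStep_eq_root_stepS hG (Sub.trans (Sub.renew e h (Sub.refl X)) hs)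
  | Gen.merge X Y e, hs => by
      have hX := rootStep_eq_root_stepS hG (Sub.trans (Sub.left Y e (Sub.refl X)) hs)
      have hY := rootStep_eq_root_stepS hG (Sub.trans (Sub.right X e (Sub.refl Y)) hs)
      by_cases h : X.rootStep ≤ Y.rootStep
      · rw [root_merge_of_le e h, Gen.rootStep_merge, min_eq_left h, hX]
      · rw [root_merge_of_not_le e h, Gen.rootStep_merge, min_eq_right (not_le.1 h).le, hY]

/-- **(p1) ROOT CELLS ARE CELLS OF THEIR ROOT SCALE (along `sh`).** [folklore] -/
theorem isScale_root_of_leafStepsS {n L K : ℕ} {G : Gen ε}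
    (hG : ∀ (b : ε) (j : ℕ), Sub (Gen.born b j) G → (sh b).step = j) {E : Finset ε} {G' : Gen ↥E}
    (hGG : gmap Subtype.val G' = G) (P₀ : ↥E → TCell d (n * L ^ K))
    (hP : ∀ b : ↥E, b.1 ∈ births G → IsScale L (sh b.1).step (P₀ b)) :
    ∀ X' : Gen ↥E, Sub X' G' → IsScale L X'.rootStep (P₀ X'.root) := by
  intro X' hX'
  have hs : Sub (gmap Subtype.val X') G := hGG ▸ sub_gmap Subtype.val hX'
  have hroot : (X'.root).1 ∈ births G :=
    births_subset_of_subE hs (by simpa using root_mem_births (gmap Subtype.val X'))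
  have hst : X'.rootStep = (sh (X'.root).1).step := by
    have h := rootStep_eq_root_stepS hG hs
    simpa using h
  rw [hst]
  exact hP X'.root hroot

/-- the root block of a sub-structure formed by step `s` lies in its zone at `s` [folklore] -/
theorem root_block_mem_regZoneS_of_le {n L K : ℕ} {G : Gen ε} (hchr : Chrono (PEv.step ∘ sh) G)
    (reg : ε → Finset (Fin d → ℕ)) {E : Finset ε} {G' : Gen ↥E} (hGG : gmap Subtype.val G' = G)
    (P₀ : ↥E → TCell d (n * L ^ K))
    (hP : ∀ b : ↥E, b.1 ∈ births G → (fun i => (P₀ b i).val / L ^ (sh b.1).step) ∈ reg b.1)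
    {X' : Gen ↥E} (hX' : Sub X' G') {s : ℕ} (hs : ftime (PEv.step ∘ sh) (gmap Subtype.val X') ≤ s) :
    (fun i => (P₀ X'.root i).val / L ^ s) ∈ regZoneS sh L reg s (gmap Subtype.val X') := by
  have hsub : Sub (gmap Subtype.val X') G := hGG ▸ sub_gmap Subtype.val hX'
  have hrX : (X'.root).1 ∈ births (gmap Subtype.val X') := by
    simpa using root_mem_births (gmap Subtype.val X')
  have hle : (sh (X'.root).1).step ≤ s :=
    (st_le_ftime_of_chrono (PEv.step ∘ sh) (chrono_of_sub (PEv.step ∘ sh) hsub hchr) _ hrX).trans hs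
  refine mem_regZoneS.2 ⟨(X'.root).1, hrX, hle, ?_⟩
  have heq : (fun i => (P₀ X'.root i).val / L ^ s) =
      fun i => ((P₀ X'.root i).val / L ^ (sh (X'.root).1).step) / L ^ (s - (sh (X'.root).1).step) := by
    funext i
    rw [Nat.div_div_eq_div_mul, ← pow_add, Nat.add_sub_cancel' hle]
  rw [heq]
  exact mem_iterate_blocks L (hP X'.root (births_subset_of_subE hsub hrX)) _

/-- **(p2) AT A MERGER BOTH PARTNERS' ROOT BLOCKS LIE IN THEIR ZONES (along `sh`).** [folklore] -/
theorem root_block_mem_regZoneS {n L K : ℕ} {G : Gen ε} (hchr : Chrono (PEv.step ∘ sh) G)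
    (reg : ε → Finset (Fin d → ℕ)) {E : Finset ε} {G' : Gen ↥E} (hGG : gmap Subtype.val G' = G)
    (P₀ : ↥E → TCell d (n * L ^ K))
    (hP : ∀ b : ↥E, b.1 ∈ births G → (fun i => (P₀ b i).val / L ^ (sh b.1).step) ∈ reg b.1) :
    ∀ (X' Y' : Gen ↥E) (e' : ↥E), Sub (Gen.merge X' Y' e') G' →
      (fun i => (P₀ X'.root i).val / L ^ (sh e'.1).step) ∈ regZoneS sh L reg (sh e'.1).step (gmap Subtype.val X') ∧
      (fun i => (P₀ Y'.root i).val / L ^ (sh e'.1).step) ∈ regZoneS sh L reg (sh e'.1).step (gmap Subtype.val Y') := by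
  intro X' Y' e' hm
  have hsub : Sub (gmap Subtype.val (Gen.merge X' Y' e')) G := hGG ▸ sub_gmap Subtype.val hm
  have hchr' : Chrono (PEv.step ∘ sh) (Gen.merge (gmap Subtype.val X') (gmap Subtype.val Y') e'.1) :=
    chrono_of_sub (PEv.step ∘ sh) hsub hchr
  obtain ⟨hfX, hfY⟩ := ftime_le_of_chrono (PEv.step ∘ sh) hchr'
  simp only [Function.comp_apply] at hfX hfY
  exact ⟨root_block_mem_regZoneS_of_le hchr reg hGG P₀ hP (Sub.trans (Sub.left Y' e' (Sub.refl X')) hm) hfX,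
    root_block_mem_regZoneS_of_le hchr reg hGG P₀ hP (Sub.trans (Sub.right X' e' (Sub.refl Y')) hm) hfY⟩

/-! ## §4 The two consumers, inputs plugged -/

section Consumers

open scoped Classical

/-- **THE REALIZED PLACEMENT IS ZONE-ADMISSIBLE** from the birth regions along `sh`. [folklore] -/
theorem admZ_of_birthRegionsS {n L K : ℕ} (hL : 1 ≤ L) {Cb : ℝ} {G : Gen ε} (hchr : Chrono (PEv.step ∘ sh) G)
    (hK : ∀ e ∈ G.events, (sh e).step ≤ K) (hG : ∀ (b : ε) (j : ℕ), Sub (Gen.born b j) G → (sh b).step = j)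
    {reg : ε → Finset (Fin d → ℕ)} (hB : BirthRegionsS sh n L K Cb G reg) {E : Finset ε} {G' : Gen ↥E}
    (hGG : gmap Subtype.val G' = G) (P₀ : ↥E → TCell d (n * L ^ K))
    (hPs : ∀ b : ↥E, b.1 ∈ births G → IsScale L (sh b.1).step (P₀ b))
    (hPr : ∀ b : ↥E, b.1 ∈ births G → (fun i => (P₀ b i).val / L ^ (sh b.1).step) ∈ reg b.1) :
    AdmZ (nearT n L K) (fun t Z => extRS sh n L K G (regZoneS sh L reg) t (gmap Subtype.val Z))
      ((PEv.step ∘ sh) ∘ Subtype.val) G' P₀ :=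
  admZ_of_readingS sh hchr hK (zoneReading_of_birthRegionsS hL hchr hB) hGG P₀
    (isScale_root_of_leafStepsS hG hGG P₀ hPs) (root_block_mem_regZoneS hchr reg hGG P₀ hPr)

/-- **THE (GM) MULTIPLICITY OF A TAGGED GENEALOGY FROM ITS BIRTH REGIONS** (`card_admZSet_le_of_readingS` with the
reading supplied by `zoneReading_of_birthRegionsS`). [folklore] -/
theorem card_admZSet_le_of_birthRegionsS (W : ε → ℕ) (n : ℕ) {L : ℕ} (hL : 1 ≤ L) (K : ℕ) {Cb σ : ℝ}
    (hCb : 0 ≤ Cb) (h0 : 0 ≤ σ) (h1 : σ < 1) (hσL : 1 / (L : ℝ) ≤ σ ^ 2) {G : Gen ε} (hW : G.WF W)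
    (hchr : Chrono (PEv.step ∘ sh) G) (hk0 : ∀ b ∈ births G, (sh b).kind = 0)
    (hk2 : ∀ m ∈ merges G, (sh m).kind ≠ 0) {reg : ε → Finset (Fin d → ℕ)} (hB : BirthRegionsS sh n L K Cb G reg)
    (E : Finset ε) (hE : G.events ⊆ E) (c c₀' : TCell d (n * L ^ K)) :
    ((admZSet (nearT n L K) (fun t Z => extRS sh n L K G (regZoneS sh L reg) t (gmap Subtype.val Z))
        ((PEv.step ∘ sh) ∘ Subtype.val) (grestrict E G hE) (grestrict E G hE).root c c₀').card : ℝ) ≤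
      ((2 : ℝ) ^ d * (max Cb (1 / (1 - σ ^ 2) + 1) + 2 * (1 / (1 - σ ^ 2)) + 1) ^ d) ^ (merges G).card *
        (∏ e ∈ merges G, Q (wcntS sh G) σ (sh e).step ^ (d : ℝ)) *
          ((L : ℝ) ^ d) ^ partnerAges (PEv.step ∘ sh) G :=
  card_admZSet_le_of_readingS sh W n hL K hCb h0 h1 hσL hW hchr hk0 hk2 (zoneReading_of_birthRegionsS hL hchr hB)
    E hE c c₀'

end Consumers

/-! ## §5 The index-model form: birth regions as reduced face-connected cube families -/

variable (sh)

/-- **THE LAWS `inRange`∕`diam_le` DISCHARGED IN THE INDEX MODEL, `Cb = 4·2^d`** (one cell ≡ one `MR_j`-cube): every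
birth `b` of `G` has a kind-`0` shape and its region is the reduced cube family `redZone (n·L^{K−(sh b).step}) (Z b)` of a
non-empty face-connected `Z b ⊆ ℤ^d` of tree length `≤ (sh b).fat`; the contact law is the history's datum. [folklore] -/
theorem birthRegionsS_of_faceConnected {n L K : ℕ} (hn : 1 ≤ n) (hL : 1 ≤ L) {G : Gen ε}
    (Z : ε → Finset (Pt d)) (hne : ∀ b ∈ births G, (Z b).Nonempty)
    (hfc : ∀ b ∈ births G, FaceConnected (Z b)) (hfat : ∀ b ∈ births G, treeLen (Z b) ≤ (sh b).fat)
    (hk0 : ∀ b ∈ births G, (sh b).kind = 0)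
    (hcontact : ∀ (X Y : Gen ε) (e : ε), Sub (Gen.merge X Y e) G →
      ∃ z, z ∈ regZoneS sh L (fun b => redZone (n * L ^ (K - (sh b).step)) (Z b)) (sh e).step X ∧
        z ∈ regZoneS sh L (fun b => redZone (n * L ^ (K - (sh b).step)) (Z b)) (sh e).step Y) :
    BirthRegionsS sh n L K (4 * 2 ^ d) G (fun b => redZone (n * L ^ (K - (sh b).step)) (Z b)) where
  inRange b _ := inRange_redZone (Nat.mul_pos hn (pow_pos hL _)) (Z b)
  diam_le b hb := by
    rw [wtPEv_of_kind0 (hk0 b hb)]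
    exact diam_redZone_le_fat (Nat.mul_pos hn (pow_pos hL _)) (hne b hb) (hfc b hb) (hfat b hb)
  contact := hcontact

/-! ## §6 Sanity (decided) -/

namespace SanityS

/-- regions of the tagged births: tag `7` ↦ `{4,5}`, tag `8` ↦ `{5,6}` (two class-`1` regions born at step `0`,
SHARING the cell `5` — in contact), everything else empty -/
def regS : PEv × ℕ → Finset (Fin 1 → ℕ) := fun ℓ =>
  if ℓ.2 = 7 then {![4], ![5]} else if ℓ.2 = 8 then {![5], ![6]} else ∅

/-- the zone of `HistoryShapeCrowd.Sanity.twinT` at step `0` is the union `{4,5,6}`; at step `1` (blocked by `L = 2`):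
`{2, 3}` -/
example : regZoneS Prod.fst 2 regS 0 HistoryZones.Sanity.twinT = {![4], ![5], ![6]} ∧
    regZoneS Prod.fst 2 regS 1 HistoryZones.Sanity.twinT = {![2], ![3]} := by decide

end SanityS

end

end Summit.QuantumFields.BalabanUV.T4Continuum.HistoryZones
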